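import Summits.CriticalPhenomena.PercolationContinuityZ3.Theorems.PercNearOneGluingNoHeavyPcintMemAutomatonCensusSum
import Summits.CriticalPhenomena.PercolationContinuityZ3.Theorems.PercNearOneGluingNoHeavyPcintMemParity
import HarnessLib

/-!
# CriticalPhenomena/PercolationContinuityZ3 — Theorems/PercNearOneGluingNoHeavyPcintClassCountLaw.lean: STRUCTURE CONJ **C3** of the pcint lane (the CLASS-COUNT / COST LAW), TYPED

HONEST FRAMING: this file types a LAW about the SIZE of the lane's memory automata (the number of kernel-certificate rows of a
memory-`τ` cell), found numerically, pre-registered and scored (coordinator STANDING RULE 2026-08-22 «NUMERICS ⇒ STRUCTURE ⇒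
CONJECTURE», item (5)); it is NOT used by any certified `p_c` interval.  Statement of record: run/shared/lean/prim/pcint/STRUCTURE.md v0.3
§1 (row CLASS-COUNT LAW C3) / §2 (C3); write-up run/shared/lean/prim/pcint/prim-pcint-2/gen13/README.md §3/§3bis.

THE OBJECT.  By the census identity (`…PcintMemAutomatonCensusSum`: `image_danger_subset_census`, `census_subset_image_danger`,
`card_census`) the set of states of the memory-`τ` dangerous-set automaton on `ℤ^d` reachable from `∅` is the disjoint union over
`m < τ` of the dangerous sets of the NEAR self-avoiding words of length `m` — those with `m + ‖ω(m)‖₁ ≤ τ` — and `ω ↦ state` is a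
bijection.  Here `nearWords d τ m` is that Finset and `memStates d τ := Σ_{m<τ} #nearWords d τ m` is the number of states (PROVED equal to
the cardinality of the reachable state set: `memStates_eq_card_census`).  The lane's engines count `B_d`-ORBITS of these
(`N_d(τ) = memStates/|B_d|` up to the axis-symmetric walks; Burnside weights reproduce every histogram bin of the lane's runs at
`d = 2, τ = 20, 22` and `d = 3, τ = 12, 14, 16(top)` TO THE UNIT, gen13/c3check).

PROVED HERE (sanity, kernel-checked): `nearWords d τ m = sawWords d m` for `2m ≤ τ` (short walks are all near), `memStates` is
monotone in `τ`, positive, and — the class-count face of the lane's PARITY LAW C2 (`mstep_odd_eq`) — `memStates d (2k+1) = memStates d (2k)`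
for `k ≥ 1` (`l1_wordPos_mod_two`: the `ℓ¹`-parity of `ω(m)` is the parity of `m`, so an odd memory adds no near word).

THE LAW (C3, conjectural part; the identity above is a theorem).  With `c_m(x)` the number of `m`-step SAWs from `0` to `x`:
`memStates d τ = Σ_{m<τ} Σ_{‖x‖₁ ≤ τ−m} c_m(x)`, and the fixed-endpoint asymptotics `c_m(x) ≍ B(x) μ^m m^{α−2}` (hyperscaling
`α − 2 = −dν`) predict: (i) **PRICE LAW** `memStates d (τ+2) / memStates d τ → μ(ℤ^d)²` — the cost of one more memory rung tends to `μ²`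
EXACTLY (not to a smaller 'effective' growth); (ii) **POLYGON FRACTION** the top piece (`m = τ−1`: closing words = oriented rooted
`τ`-step polygons, `2τ p_τ(ℤ^d)`) is a fixed positive fraction `1/K_d` of all states in the limit (equivalently the forgotten-sites
profile is stationary); numerically `K_2 = 4.82 → 4.67` (τ = 20..26), `K_3 = 2.90 → 2.85 → (2.83)` (τ = 12..18), `K_4/K_5/K_6(14) = 2.40/2.25/2.21`.
Consequence: `N_d(τ) ≍ μ^τ τ^{−dν}` (measured local exponent `d = 2`: −1.60 ± 0.02 over τ = 14..26; `d = 3`: −2.05 → −1.84).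
EVIDENCE LEDGER: identity verified on 42 + 26 histogram bins (d = 2 τ20/22, d = 3 τ12/14) and the top bins at d = 2 τ20–26 (= 2τp_τ/8,
OEIS A002931) and d = 3 τ12/14/16 (= [2τp_τ(ℤ³) + 3·2τp_τ(ℤ²)]/48, p_τ(ℤ³) = 31 754 / 452 640 / 6 840 774); PRE-REGISTERED predictions,
all sealed as evidence on stmt-CriticalPhenomena-4575 BEFORE their runs and SCORED by prim-pcint-2 gen 13 (STRUCTURE.md §3): P8 (gate stamp
2026-08-23T04:24Z): N_5(16) ∈ [3.69, 4.10]·10⁸ → 393 539 459 HIT (d = 6 item pending at filing); P8g (05:17Z): d = 5 τ16 profile rel(1..4) =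
0.740/0.329/0.105/0.026 within ±0.02 of the τ14 profile, K_5(16) = 2.2055 ∈ [2.20, 2.25] — HIT ×5; P9 (05:38Z): d = 3 τ18: classes 229 530 081,
top bin ∈ band, profile rel(1..5) = 0.9023/0.5427/0.2478/0.0949/0.0309 in bands, K_3(18) = 2.8302 ∈ [2.8288, 2.8308] — ALL HIT; P9x (06:05Z,
ZERO TOLERANCE): all 18 histogram bins of the d = 3 τ = 18 automaton (kit j185265) predicted from SAW enumeration by the identity —
HIT, EVERY BIN EXACT (e.g. bins 13..17 = 7 696 854 / 20 100 668 / 44 010 674 / 73 174 718 / 81 100 527; Σ = 229 530 081); P10 (06:58Z, zero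
tolerance: p_16(ℤ⁴) = 723 317 892, p_16(ℤ⁵) = 17 452 391 500 implied by the identity from the d = 4, 5 histograms) pending a direct enumeration.  Nearest print: Pönitz–Tittmann 2000 §2 (state generation with an
`ℓ¹` reach test; no count law).  Written by prim-pcint-2 gen 13 (prover-prim-pcint-2-g13-0), 2026-08-23.
-/

noncomputable section

open Filter Topology
open Literature.Probability.LatticeModels Literature.Probability.Percolation
open Literature.Probability.RandomPlanarGeometry.SAW.Zd (connectiveConstant count)
open Summit.CriticalPhenomena.PercolationContinuityZ3.Theorems.Pcint
  (IsMem MState l1 l1_sub_stepVec_add_odd danger mem_danger)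

namespace Summit.CriticalPhenomena.PercolationContinuityZ3.Theorems.Pcint.MemoryTail

variable {d : ℕ}

/-! ### The objects -/

open Classical in
/-- The NEAR self-avoiding words of length `m` for memory `τ`: self-avoiding, with `m + ‖ω(m)‖₁ ≤ τ` (exactly the words all of whose
sites are still dangerous; `allKept_iff_near`).  Their dangerous sets are the states of the memory-`τ` automaton (`card_census`).
[folklore] -/
def nearWords (d τ m : ℕ) : Finset (Fin m → Fin d × Bool) :=
  (sawWords d m).filter fun w => l1 (wordPos w m) ≤ τ - m

/-- **`memStates d τ`** = the number of states of the memory-`τ` dangerous-set automaton on `ℤ^d` reachable from `∅`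
(`= Σ_{m<τ} #nearWords d τ m` by definition; `= #⋃ states` by `memStates_eq_card_census`).  The lane's class count `N_d(τ)` is the
number of `B_d`-orbits of these states. [folklore] -/
def memStates (d τ : ℕ) : ℕ := ∑ m ∈ Finset.range τ, (nearWords d τ m).card

open Classical in
/-- `memStates` IS the number of reachable states: the census union of `…CensusSum` has exactly `memStates d τ` elements.
[folklore] -/
theorem memStates_eq_card_census (d τ : ℕ) :
    memStates d τ = ((Finset.range τ).biUnion fun m =>
      ((sawWords d m).filter fun w => l1 (wordPos w m) ≤ τ - m).image (danger τ)).card := by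
  rw [card_census]; rfl

/-! ### Sanity: short walks are all near; monotonicity; parity -/

/-- For `2m ≤ τ` every self-avoiding word of length `m` is near (`‖ω(m)‖₁ ≤ m ≤ τ − m`). [folklore] -/
theorem nearWords_eq_sawWords {τ m : ℕ} (h : 2 * m ≤ τ) (d : ℕ) : nearWords d τ m = sawWords d m := by
  classical
  unfold nearWords
  refine Finset.filter_true_of_mem fun w _ => ?_
  exact (l1_wordPos_le w m le_rfl).trans (by omega)

/-- `nearWords` grows with the memory. [folklore] -/
theorem nearWords_mono {τ τ' : ℕ} (h : τ ≤ τ') (d m : ℕ) : nearWords d τ m ⊆ nearWords d τ' m := by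
  classical
  intro w hw
  unfold nearWords at hw ⊢
  rw [Finset.mem_filter] at hw ⊢
  exact ⟨hw.1, hw.2.trans (by omega)⟩

/-- `memStates` is monotone in `τ`. [folklore] -/
theorem memStates_mono {τ τ' : ℕ} (h : τ ≤ τ') (d : ℕ) : memStates d τ ≤ memStates d τ' := by
  unfold memStates
  calc ∑ m ∈ Finset.range τ, (nearWords d τ m).card ≤ ∑ m ∈ Finset.range τ, (nearWords d τ' m).card :=
        Finset.sum_le_sum fun m _ => Finset.card_le_card (nearWords_mono h d m)
    _ ≤ ∑ m ∈ Finset.range τ', (nearWords d τ' m).card :=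
        Finset.sum_le_sum_of_subset_of_nonneg (Finset.range_subset_range.2 h) fun _ _ _ => Nat.zero_le _

/-- `memStates d τ ≥ 1` for `τ ≥ 1` (the empty state). [folklore] -/
theorem one_le_memStates {τ : ℕ} (hτ : 1 ≤ τ) (d : ℕ) : 1 ≤ memStates d τ := by
  classical
  unfold memStates
  have h0 : 0 ∈ Finset.range τ := Finset.mem_range.2 (by omega)
  have h1 : 1 ≤ (nearWords d τ 0).card := by
    rw [nearWords_eq_sawWords (by omega) d, Finset.one_le_card]
    exact ⟨fun i => i.elim0, mem_sawWords.2 fun i j hi hj _ => by omega⟩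
  exact h1.trans (Finset.single_le_sum (f := fun m => (nearWords d τ m).card) (fun m _ => Nat.zero_le _) h0)

/-- The `ℓ¹`-parity of the position after `m` steps is the parity of `m`. [folklore] -/
theorem l1_wordPos_mod_two {n : ℕ} (w : Fin n → Fin d × Bool) : ∀ m, m ≤ n → l1 (wordPos w m) % 2 = m % 2 := by
  intro m
  induction m with
  | zero => intro _; simp [l1]
  | succ m ih =>
    intro hm
    have hstep : wordPos w m = wordPos w (m + 1) - stepVec (w ⟨m, by omega⟩) := by
      rw [wordPos_succ w (by omega : m < n)]; abel
    have hodd := l1_sub_stepVec_add_odd (wordPos w (m + 1)) (w ⟨m, by omega⟩)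
    rw [← hstep] at hodd
    have hih := ih (by omega)
    omega

/-- An odd memory adds no near word: `nearWords d (2k+1) m = nearWords d (2k) m` (parity: `‖ω(m)‖₁ ≡ m`, so the bound `2k+1−m`, of
the wrong parity, is never attained). [folklore] -/
theorem nearWords_odd (d k m : ℕ) : nearWords d (2 * k + 1) m = nearWords d (2 * k) m := by
  classical
  unfold nearWords
  refine Finset.filter_congr fun w _ => ?_
  have hp := l1_wordPos_mod_two w m le_rfl
  constructor <;> intro h <;> omega

/-- For `k ≥ 1` there is no near word of length `2k` at memory `2k + 1` (it would be a `2k`-step SAW back at the origin). [folklore] -/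
theorem nearWords_odd_top {k : ℕ} (hk : 1 ≤ k) (d : ℕ) : nearWords d (2 * k + 1) (2 * k) = ∅ := by
  classical
  unfold nearWords
  refine Finset.filter_false_of_mem fun w hw => ?_
  rw [mem_sawWords] at hw
  intro h
  have hp := l1_wordPos_mod_two w (2 * k) le_rfl
  have h0 : l1 (wordPos w (2 * k)) = 0 := by omega
  have hz : wordPos w (2 * k) = 0 := by
    funext i
    have := Finset.sum_eq_zero_iff.1 h0 i (Finset.mem_univ i)
    simpa using this
  have := hw 0 (2 * k) (by omega) le_rfl (by rw [wordPos_zero, hz])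
  omega

/-- **Parity law for the state count** (the class-count face of C2 / `mstep_odd_eq`): `memStates d (2k+1) = memStates d (2k)` for `k ≥ 1`.
[folklore] -/
theorem memStates_odd {k : ℕ} (hk : 1 ≤ k) (d : ℕ) : memStates d (2 * k + 1) = memStates d (2 * k) := by
  unfold memStates
  rw [Finset.sum_range_succ, nearWords_odd_top hk d, Finset.card_empty, add_zero]
  exact Finset.sum_congr rfl fun m _ => by rw [nearWords_odd]

/-! ### The law (conjectural part), typed -/

/-- **C3 (i), PRICE LAW**: for every `d ≥ 2`, along even memories the cost of one more memory rung tends to `μ(ℤ^d)²` exactly: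
`memStates d (2m+2) / memStates d (2m) → μ(ℤ^d)²`.  Evidence: `d = 2`: ratios 5.239, 5.452, 5.618, 5.755, 5.871, 5.968, 6.052, 6.123
(τ = 10→26; μ² = 6.960; local exponent of N/μ^τ stable at −1.60 ± 0.02, i.e. ratio = μ²(1 − 1.6·2/τ + …)); `d = 3`: 15.10, 16.32, 17.10,
17.66 (μ² = 21.94); `d = 4/5/6`: 26.1→33.0 / 32.0→41.2 / 32.8→45.0 (μ² = 45.9 / 78.1 / 118.3), all rising.  Mechanism: census identity +
fixed-endpoint SAW asymptotics `c_m(x) ≍ B(x) μ^m m^{α−2}`.  STRUCTURE CONJ C3 (prim-pcint-2 gen 13, 2026-08-23; STRUCTURE.md v0.3 §2;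
not kernel-checked). -/
@[conjecture] def priceLaw : Prop :=
  ∀ d : ℕ, 2 ≤ d →
    Tendsto (fun m : ℕ => (memStates d (2 * m + 2) : ℝ) / memStates d (2 * m)) atTop (𝓝 (connectiveConstant d ^ 2))

/-- **C3 (ii), POLYGON FRACTION**: for every `d ≥ 2` the closing words (oriented rooted polygons opened at the root, the top census
piece `m = τ − 1`) are an asymptotically CONSTANT positive fraction `1/K_d` of all states along even `τ`:
`#nearWords d (2m) (2m−1) / memStates d (2m) → 1/K_d > 0`.  Evidence: `d = 2`: 0.2073, 0.2099, 0.2122, 0.2142 (τ = 20..26; K_2 = 4.82 → 4.67);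
`d = 3`: 0.3450, 0.3489, 0.3514 (τ = 12..16; K_3 = 2.90 → 2.85); `d = 4/5/6` (τ14): 0.416 / 0.445 / 0.453; the whole forgotten-sites profile
is stationary to ±0.015 per rung (P8g).  STRUCTURE CONJ C3 (prim-pcint-2 gen 13, 2026-08-23; STRUCTURE.md v0.3 §2; not kernel-checked). -/
@[conjecture] def polygonFraction : Prop :=
  ∀ d : ℕ, 2 ≤ d → ∃ c : ℝ, 0 < c ∧
    Tendsto (fun m : ℕ => ((nearWords d (2 * m) (2 * m - 1)).card : ℝ) / memStates d (2 * m)) atTop (𝓝 c)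

end Summit.CriticalPhenomena.PercolationContinuityZ3.Theorems.Pcint.MemoryTail
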